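import Mathlib.Algebra.BigOperators.Ring.Finset
import Mathlib.Algebra.Order.BigOperators.Group.Finset
import Mathlib.Algebra.Order.BigOperators.Ring.Finset
import Mathlib.Data.Fintype.BigOperators
import Mathlib.Data.Fintype.Pi
import HarnessLib

/-!
# Many marked coordinates are rare: the exponential-moment tail over a product set (counting form)

Topic `Literature/Computability/Complexity`, companion of `PlantedSampleHiding.lean` (the
posterior-odds lemma of Akavia–Goldreich–Goldwasser–Moshkovitz's hiding device: given the VALUES
of the pool, each position is "planted" independently, with small probability at a light value)
and of `SamplingDeviation*.lean` (Chebyshev in counting form, for IDENTICALLY distributed trials).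
The soundness analysis of AGGM's App. D protocol (STOC 2006; preprint printed p. 21: "if the prover
cheats on a light query, it is likely to cheat on `y` drawn from `f(Uₙ)`") needs a tail bound for
the number of planted positions inside the set of positions a prover cheats on, where — after
conditioning on the pool values — the positions are independent but NOT identically distributed.
The exponential-moment method needs nothing but the product structure, so it is the cheap tool
here (Arora–Barak, proof of Thm. A.14: bound `Pr[X ≥ u] · 2ᵘ ≤ 𝔼[2^X] = Π 𝔼[2^{Xⱼ}]`):

* `card_marked_ge_mul_two_pow_le` — for finite types `F j` (`j ∈ ι`), "marked" subsets
  `Pl j ⊆ F j` and a set of positions `C`, the points `x` of the product `Π j, F j` with at least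
  `u` marked coordinates in `C` satisfy
  `#{x | u ≤ #{j ∈ C | x j ∈ Pl j}} · 2ᵘ ≤ Π_{j ∈ C} (|F j| + |Pl j|) · Π_{j ∉ C} |F j|`
  (exact arithmetic in `ℕ`; dividing by `|Π F| = Π |F j|` this is
  `Pr[≥ u marked in C] ≤ 2⁻ᵘ Π_{j ∈ C} (1 + κⱼ)`, `κⱼ = |Pl j| / |F j|`, `≤ e^{Σ κⱼ} / 2ᵘ`);
* `two_pow_card_filter_eq_prod` — the identity `2^{#{j ∈ C | p j}} = Π_{j ∈ C} (if p j then 2 else 1)`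
  behind it, and `sum_prod_marks_eq` — the product-sum swap evaluating `Σₓ Π_{j ∈ C} (…)`.

Mathlib only, all proved, [folklore] (the method) with the AGGM use cited.

## References

* S. Arora, B. Barak, *Computational Complexity: A Modern Approach*, CUP 2009, Thm. A.14 (Chernoff
  bound via the moment generating function).
* A. Akavia, O. Goldreich, S. Goldwasser, D. Moshkovitz, *On basing one-way functions on
  NP-hardness*, STOC 2006, App. B.2.3 (Thm. 12) and App. D (printed p. 21).
-/

namespace Literature.Computability.Complexity

open Finset

variable {ι : Type*} [Fintype ι] [DecidableEq ι] {F : ι → Type*} [∀ j, Fintype (F j)]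
  [∀ j, DecidableEq (F j)]

omit [Fintype ι] [DecidableEq ι] in
/-- `2^{#{j ∈ C | p j}} = Π_{j ∈ C} (if p j then 2 else 1)`. [folklore] -/
theorem two_pow_card_filter_eq_prod (C : Finset ι) (p : ι → Prop) [DecidablePred p] :
    2 ^ (C.filter p).card = ∏ j ∈ C, (if p j then 2 else 1 : ℕ) := by
  rw [prod_ite, prod_const_one, mul_one, prod_const]

/-- **The product-sum swap for marks**: summing over all points of the product the weight
`Π_{j ∈ C} (if xⱼ marked then 2 else 1)` gives `Π_{j ∈ C} (|F j| + |Pl j|) · Π_{j ∉ C} |F j|`.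
[folklore] -/
theorem sum_prod_marks_eq (C : Finset ι) (Pl : ∀ j, Finset (F j)) :
    ∑ x : (∀ j, F j), ∏ j ∈ C, (if x j ∈ Pl j then 2 else 1 : ℕ) =
      (∏ j ∈ C, (Fintype.card (F j) + (Pl j).card)) * ∏ j ∈ univ \ C, Fintype.card (F j) := by
  -- extend the weight to all coordinates
  have hext : ∀ x : (∀ j, F j), ∏ j ∈ C, (if x j ∈ Pl j then 2 else 1 : ℕ) =
      ∏ j, (if j ∈ C then (if x j ∈ Pl j then 2 else 1) else 1 : ℕ) := by
    intro x
    rw [prod_ite_mem, univ_inter]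
  simp_rw [hext]
  -- swap: `Σₓ Πⱼ wⱼ(xⱼ) = Πⱼ Σₐ wⱼ(a)`
  rw [← Fintype.piFinset_univ, ← Finset.prod_univ_sum (t := fun _ => (univ : Finset _))
    (f := fun j a => (if j ∈ C then (if a ∈ Pl j then 2 else 1) else 1 : ℕ))]
  -- evaluate the one-coordinate sums and split the product at `C`
  have hone : ∀ j, ∑ a : F j, (if j ∈ C then (if a ∈ Pl j then 2 else 1) else 1 : ℕ) =
      if j ∈ C then Fintype.card (F j) + (Pl j).card else Fintype.card (F j) := by
    intro j
    by_cases hj : j ∈ C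
    · simp only [hj, if_true]
      have h2 : ∀ a : F j, (if a ∈ Pl j then 2 else 1 : ℕ) = 1 + (if a ∈ Pl j then 1 else 0) := by
        intro a; split_ifs <;> rfl
      simp_rw [h2]
      rw [sum_add_distrib, sum_boole, sum_const, card_univ, filter_mem_eq_inter, univ_inter]
      simp
    · simp [hj]
  simp_rw [hone]
  rw [prod_ite, filter_mem_eq_inter, univ_inter]
  congr 1
  refine prod_congr ?_ fun _ _ => rfl
  ext j
  simp [mem_sdiff]

/-- **Many marked coordinates are rare (exponential moment, counting form).** For marked subsets
`Pl j ⊆ F j` and a set of positions `C`, the points of `Π j, F j` with at least `u` marked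
coordinates in `C` satisfy
`#{x | u ≤ #{j ∈ C | x j ∈ Pl j}} · 2ᵘ ≤ Π_{j ∈ C} (|F j| + |Pl j|) · Π_{j ∉ C} |F j|`, i.e.
`Pr[≥ u marked] ≤ 2⁻ᵘ Π_{j ∈ C} (1 + |Pl j|/|F j|)`. In AGGM's App. D: given the pool values, a
prover cheating on the positions `C` hits `≥ u` planted ones only with this probability (planted
odds `κ` at light values, `PlantedSampleHiding.plantWeight_odds`), so cheating on many planted
positions means cheating on many decoys. [cite: AroraBarak2009, Thm. A.14 (proof)] -/
theorem card_marked_ge_mul_two_pow_le (C : Finset ι) (Pl : ∀ j, Finset (F j)) (u : ℕ) :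
    (univ.filter fun x : (∀ j, F j) => u ≤ (C.filter fun j => x j ∈ Pl j).card).card * 2 ^ u ≤
      (∏ j ∈ C, (Fintype.card (F j) + (Pl j).card)) * ∏ j ∈ univ \ C, Fintype.card (F j) := by
  rw [← sum_prod_marks_eq C Pl, card_eq_sum_ones, sum_mul, one_mul]
  calc ∑ x ∈ univ.filter (fun x : (∀ j, F j) => u ≤ (C.filter fun j => x j ∈ Pl j).card), 2 ^ u
      ≤ ∑ x ∈ univ.filter (fun x : (∀ j, F j) => u ≤ (C.filter fun j => x j ∈ Pl j).card),
          ∏ j ∈ C, (if x j ∈ Pl j then 2 else 1 : ℕ) := by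
        refine sum_le_sum fun x hx => ?_
        rw [mem_filter] at hx
        rw [← two_pow_card_filter_eq_prod]
        exact Nat.pow_le_pow_right (by norm_num) hx.2
    _ ≤ ∑ x : (∀ j, F j), ∏ j ∈ C, (if x j ∈ Pl j then 2 else 1 : ℕ) :=
        sum_le_sum_of_subset_of_nonneg (filter_subset _ _) fun _ _ _ => Nat.zero_le _

end Literature.Computability.Complexity
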